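import Summits.QuantumAdvantage.AdviceFreeQNC0.OddPrimeTransport
import Summits.QuantumAdvantage.AdviceFreeQNC0.RingClassCount
import Literature.Computability.MetaComplexity.SmolenskyCorrelation
import HarnessLib

/-!
# Cell qa-qnc0 (rung F-Q2-odd, `p = 3`): the D-WALK NORMAL FORM of the ring game — statements and plan A2

Planner qa-qnc0-p1 g16, `ROUND-15.md` / `Sketch19.lean` (statements VERBATIM: `Mk3` (with the tree's `sgn3`), `Dk3`,
`OneBellDWB3`, `PredHardDWB3`, `BShotDWB3`, `DWalkTwoThirds3`, `OneBellOfPred`, `NormalFormPlan3`,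
`DenseResidual3`, `ringHardOdd_three_of_pieces`).  PROVED here (ask A2 of ROUND-15 §6):

* the dictionary `Mk3 x k = k + W_k` in `𝔽₃` (`Mk3_eq`; `s_i = 1 + [u_i]` since `-1 = 2`), so that the ring's hit
  condition `(k + N + W_k + W_{N-1}) % 3 ≠ 2` of `WalkCoordinates.traceForm` reads `Dk3 x k ≠ 1` (`dk3_ne_one_iff`);
* **`normalFormPlan3 : NormalFormPlan3`** (`DWalkTwoThirds3 → RingHardOdd 3`, `θ = 5/6`): the bells
  `w_k x := [[P_k x = 1] ⊕ t(x)_k]` (`bellOf`) of a degree-`(log₂ N)^c` ring strategy `P` have `𝔽₃`-degree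
  `≤ 2(log₂ N)^c + 2 ≤ (log₂ N)^{c+1}` for `N ≥ 16` (`ind_eq_one_mem_lowDeg`, `ind_tGuess_mem_lowDeg_two`,
  `ind_xor_mem_lowDeg` of `OddPrimeTransport.lean`), and by `traceForm` the ring relation holds at an odd-class `x`
  iff an odd number of ringing bells `k` have `Dk3 x k ≠ 1`; `DWalkTwoThirds3` at `ε = 1/4`, `C = c + 1` gives
  `#solved odd ≤ (5/12)·2^N = (5/6)·2^{N-1}`.

The companion plan P-15a `oneBellOfPred : PredHardDWB3 → OneBellDWB3` is `DWalkOneBell.lean`.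

WHAT THIS IS NOT: `PredHardDWB3`, `BShotDWB3`, `DWalkTwoThirds3` (hence `OneBellDWB3`, `RingHardOdd 3`) are NOT
proved here (ROUND-15 §3 has memo-level proofs of the first two; the dense regime is open); separation NOT moved.
-/

noncomputable section

namespace Summit.QuantumAdvantage.AdviceFreeQNC0

open Classical
open Finset
open Literature.Computability.QuantumComplexity Literature.Computability.QuantumComplexity.RingHLF
open Literature.Computability.MetaComplexity Literature.Computability.MetaComplexity.Smolensky

variable {N : ℕ}

/-! ### Statements (planner qa-qnc0-p1 g16, `Sketch19.lean` — verbatim) -/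

/-- The mod-3 walk `M_k = Σ_{i<k} s_i ∈ 𝔽₃` with the walk SIGN `s_i = (-1)^{u_i} ∈ {±1} ⊂ 𝔽₃` (Sketch18 §2,
verbatim up to spelling: the Sketch's `sgn3 x i := if uCoord x i then -1 else 1` is the tree's
`sgn3 (uCoord x i)` of `RingClassCount.lean`, definitionally — one name, one module). -/
def Mk3 (x : Fin N → Bool) (k : ℕ) : ZMod 3 :=
  ∑ i ∈ univ.filter (fun i : Fin N => i.val < k), sgn3 (uCoord x i)

/-- The two-sided walk `D_k = M_k + M_{N-1} ∈ 𝔽₃` (ring ⟺ `D_k ≠ 1`). (Sketch18 §6, verbatim.) -/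
def Dk3 (x : Fin N → Bool) (k : ℕ) : ZMod 3 := Mk3 x k + Mk3 x (N - 1)

/-- **R3 `OneBellDWB3`** — domain-wall blindness (Sketch18 §6, verbatim).  THEOREM by ROUND-15 (via `PredHardDWB3`
and `OneBellOfPred`), memo level. -/
def OneBellDWB3 : Prop :=
  ∀ ε : ℝ, 0 < ε → ∀ C : ℕ, ∃ n₀ : ℕ, ∀ N ≥ n₀, ∀ k : Fin N,
    ∀ w : Smolensky.CubeFn (ZMod 3) N, w ∈ Smolensky.lowDeg (ZMod 3) N ((Nat.log 2 N) ^ C) →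
      (3 * ((univ.filter fun x : Fin N → Bool =>
          (univ.filter fun b : Fin N => x b = false).card % 2 = 1 ∧ w x = 1 ∧ Dk3 x k.val ≠ 1).card : ℝ)
        ≤ 2 * ((univ.filter fun x : Fin N → Bool =>
          (univ.filter fun b : Fin N => x b = false).card % 2 = 1 ∧ w x = 1).card : ℝ) + ε * (2 : ℝ) ^ N)

/-- **THEOREM A′ `PredHardDWB3`** (ROUND-15 §2/§3): for every cut `k`, no `𝔽₃`-polynomial `g` of degree
`≤ (log₂ N)^C` in the input bits predicts the stake `D_k` on more than `(1/3 + ε)·2^{N-1}` odd-class inputs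
(`2^{N-1} + ε 2^N ≥ 3·#{…}` ⟺ `#{…} ≤ (1/3 + 2ε/3) 2^{N-1}`).  Mechanism: Kilian gauge on a bell-free window
lifted to the bits (degree-preserving), structured window law `T_ω = Σ_j S_j` (`S_j` long parities), Smolensky's
`parity_agreement_le`; the three hypotheses `T_ω = t` give three distinct predicted values, so `Σ_t P_t ≤ 1`. -/
def PredHardDWB3 : Prop :=
  ∀ ε : ℝ, 0 < ε → ∀ C : ℕ, ∃ n₀ : ℕ, ∀ N ≥ n₀, ∀ k : Fin N,
    ∀ g : Smolensky.CubeFn (ZMod 3) N, g ∈ Smolensky.lowDeg (ZMod 3) N ((Nat.log 2 N) ^ C) →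
      (3 * ((univ.filter fun x : Fin N → Bool =>
          (univ.filter fun b : Fin N => x b = false).card % 2 = 1 ∧ g x = Dk3 x k.val).card : ℝ)
        ≤ (2 : ℝ) ^ (N - 1) + ε * (2 : ℝ) ^ N)

/-- **THEOREM A `BShotDWB3`** (ROUND-15 §2/§3, the B-shot two-thirds law): a bell vector `w = (w_k)_{k<N}` of
`𝔽₃`-polynomials of degree `≤ (log₂ N)^C` that rings (`w_k x = 1`) at most `B` bells on every odd-class input,
`B⁴ ≤ N`, wins (odd number of ringing bells `k` with `D_k ≠ 1`) on at most `(2/3 + ε)·2^{N-1}` odd-class inputs.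
Positions and number of bells are fully adaptive; one-flip shows `2/3` is attained.  The proof gives
`B ≤ N^{1/3}/polylog`; `B⁴ ≤ N` is stated for robustness. -/
def BShotDWB3 : Prop :=
  ∀ ε : ℝ, 0 < ε → ∀ C : ℕ, ∃ n₀ : ℕ, ∀ N ≥ n₀,
    ∀ w : Fin N → Smolensky.CubeFn (ZMod 3) N,
      (∀ k, w k ∈ Smolensky.lowDeg (ZMod 3) N ((Nat.log 2 N) ^ C)) →
      (∀ x : Fin N → Bool, (univ.filter fun b : Fin N => x b = false).card % 2 = 1 →
        (univ.filter fun k : Fin N => w k x = 1).card ^ 4 ≤ N) →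
      (3 * ((univ.filter fun x : Fin N → Bool =>
          (univ.filter fun b : Fin N => x b = false).card % 2 = 1 ∧
            (univ.filter fun k : Fin N => w k x = 1 ∧ Dk3 x k.val ≠ 1).card % 2 = 1).card : ℝ)
        ≤ (2 : ℝ) ^ N + ε * (2 : ℝ) ^ N)

/-- **R4 `DWalkTwoThirds3`** — the full statement in normal form (ALL polylog-degree bell vectors win on at most
`(2/3 + ε)·2^{N-1}` odd-class inputs).  `NormalFormPlan3` turns it into `RingHardOdd 3`; `BShotDWB3` is its proved
(memo-level) sparse case; the dense case is OPEN (ROUND-15 §4). -/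
def DWalkTwoThirds3 : Prop :=
  ∀ ε : ℝ, 0 < ε → ∀ C : ℕ, ∃ n₀ : ℕ, ∀ N ≥ n₀,
    ∀ w : Fin N → Smolensky.CubeFn (ZMod 3) N,
      (∀ k, w k ∈ Smolensky.lowDeg (ZMod 3) N ((Nat.log 2 N) ^ C)) →
      (3 * ((univ.filter fun x : Fin N → Bool =>
          (univ.filter fun b : Fin N => x b = false).card % 2 = 1 ∧
            (univ.filter fun k : Fin N => w k x = 1 ∧ Dk3 x k.val ≠ 1).card % 2 = 1).card : ℝ)
        ≤ (2 : ℝ) ^ N + ε * (2 : ℝ) ^ N)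

/-! ### Plans (implications; sizes S unless said) -/

/-- P-15a (S): the two-predictor argument of ROUND-15 §2 (`g_a := 1 + (a-1)·(1 - (w-1)²)`, `a = 0, 2`, plus
`|#{x odd : D_k x = 1} − 2^{N-1}/3| ≤ 2`). PROVED below: `oneBellOfPred`. -/
def OneBellOfPred : Prop := PredHardDWB3 → OneBellDWB3

/-- P-15b (S): normal form ⇒ the rung.  `traceForm` (hit ⟺ `(k+N+W_k+W_{N-1}) % 3 ≠ 2` ⟺ `Dk3 x k ≠ 1`, using
`M_k = k + W_k` in `𝔽₃`), bells `w_k x := [P k x = 1] ⊕ tGuess x k` have degree `≤ 2·deg(P k) + 2` (indicator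
`1 - (P-1)²`, `tGuess_j = x_j ⊕ x_{j+1}`), and `θ := 2/3 + ε < 1` with one `n₀` per `c` (small `n` absorbed).
PROVED below: `normalFormPlan3`. -/
def NormalFormPlan3 : Prop := DWalkTwoThirds3 → RingHardOdd 3

/-- **The remaining crux, as the residual** (ROUND-15 §4.5): the DENSE regime.  Stated as an implication because
"rings `≤ B` bells on every input" has no low-degree indicator, so a strategy does not split into a sparse and a
dense strategy.  OPEN; no mechanism (ROUND-15 §4 lists what the transport reduces it to and why it stops). -/
def DenseResidual3 : Prop := BShotDWB3 → DWalkTwoThirds3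

/-- Bookkeeping (term-level, for the record): the rung from the three pieces. -/
theorem ringHardOdd_three_of_pieces (h₁ : BShotDWB3) (h₂ : DenseResidual3) (h₃ : NormalFormPlan3) :
    RingHardOdd 3 := h₃ (h₂ h₁)

/-! ### The dictionary `M_k = k + W_k` -/

/-- `s_i = 1 + [u_i]` in `𝔽₃` (`-1 = 2`). -/
theorem sgn3_uCoord_eq (x : Fin N → Bool) (i : Fin N) :
    sgn3 (uCoord x i) = 1 + (if uCoord x i = true then 1 else 0) := by
  unfold sgn3
  cases uCoord x i <;> decide

/-- **`M_k = k + W_k` in `𝔽₃`** for `k ≤ N`. -/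
theorem Mk3_eq (x : Fin N → Bool) {k : ℕ} (hk : k ≤ N) :
    Mk3 x k = (k : ZMod 3) + (Wk x k : ZMod 3) := by
  unfold Mk3 Wk
  simp_rw [sgn3_uCoord_eq]
  rw [Finset.sum_add_distrib, Finset.sum_const, Finset.sum_boole, nsmul_eq_mul, mul_one,
    Finset.filter_filter]
  congr 1
  rw [Fin.card_filter_val_lt, min_eq_right hk]

/-- **The hit condition in normal form**: for `k < N`, `Dk3 x k ≠ 1 ↔ (k + N + W_k + W_{N-1}) % 3 ≠ 2`
(the right-hand side is the stake of `WalkCoordinates.traceForm`). -/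
theorem dk3_ne_one_iff (x : Fin N → Bool) (k : Fin N) :
    Dk3 x k.val ≠ 1 ↔ (k.val + N + Wk x k.val + Wk x (N - 1)) % 3 ≠ 2 := by
  have hN : 1 ≤ N := by have := k.isLt; omega
  unfold Dk3
  rw [Mk3_eq x k.isLt.le, Mk3_eq x (Nat.sub_le N 1)]
  have hcast : (k.val : ZMod 3) + (Wk x k.val : ZMod 3) + (((N - 1 : ℕ) : ZMod 3) + (Wk x (N - 1) : ZMod 3)) =
      ((k.val + Wk x k.val + (N - 1) + Wk x (N - 1) : ℕ) : ZMod 3) := by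
    push_cast; ring
  rw [hcast, show (1 : ZMod 3) = ((1 : ℕ) : ZMod 3) by norm_num, Ne, Ne,
    ZMod.natCast_eq_natCast_iff']
  constructor
  · intro h h'; apply h; omega
  · intro h h'; apply h; omega

/-- `Dk3 x k = 1 ↔ (k + N + W_k + W_{N-1}) % 3 = 2`. -/
theorem dk3_eq_one_iff (x : Fin N → Bool) (k : Fin N) :
    Dk3 x k.val = 1 ↔ (k.val + N + Wk x k.val + Wk x (N - 1)) % 3 = 2 := by
  have h := dk3_ne_one_iff x k
  tauto

/-! ### A2: `NormalFormPlan3` -/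

/-- The bell `[[P x = 1] ⊕ t(x)_k]` as an `𝔽₃`-valued function. -/
def bellOf (P : CubeFn (ZMod 3) N) (k : Fin N) : CubeFn (ZMod 3) N :=
  fun x => if xor (decide (P x = 1)) (tGuess x k) = true then 1 else 0

/-- The bell rings (`= 1`) iff `[P x = 1] ⊕ t(x)_k`. -/
theorem bellOf_eq_one_iff (P : CubeFn (ZMod 3) N) (k : Fin N) (x : Fin N → Bool) :
    bellOf P k x = 1 ↔ xor (decide (P x = 1)) (tGuess x k) = true := by
  unfold bellOf
  by_cases h : xor (decide (P x = 1)) (tGuess x k) = true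
  · simp [h]
  · rw [if_neg h]
    constructor
    · intro h0; exact absurd h0 (by decide)
    · intro h1; exact absurd h1 h

/-- The bell has degree `≤ 2D + 2`. -/
theorem bellOf_mem_lowDeg {D : ℕ} {P : CubeFn (ZMod 3) N} (hP : P ∈ lowDeg (ZMod 3) N D) (k : Fin N) :
    bellOf P k ∈ lowDeg (ZMod 3) N (2 * D + 2) := by
  have h1 : (fun x => if decide (P x = 1) = true then (1 : ZMod 3) else 0) ∈ lowDeg (ZMod 3) N (2 * D) := by
    have h := ind_eq_one_mem_lowDeg hP
    have heq : (fun x => if decide (P x = 1) = true then (1 : ZMod 3) else 0) =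
        fun x => if P x = 1 then (1 : ZMod 3) else 0 := by
      funext x; simp only [decide_eq_true_eq]
    rw [heq]
    exact h
  exact ind_xor_mem_lowDeg h1 (ind_tGuess_mem_lowDeg_two k)

/-- Degree bookkeeping: `2·(log₂ N)^c + 2 ≤ (log₂ N)^{c+1}` once `log₂ N ≥ 4`. -/
private theorem deg_bookkeeping {N : ℕ} (hN : 16 ≤ N) (c : ℕ) :
    2 * (Nat.log 2 N) ^ c + 2 ≤ (Nat.log 2 N) ^ (c + 1) := by
  have hlog : 4 ≤ Nat.log 2 N := Nat.le_log_of_pow_le (by norm_num) hN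
  have hone : 1 ≤ (Nat.log 2 N) ^ c := Nat.one_le_pow _ _ (by omega)
  rw [pow_succ]
  nlinarith

/-- **A2 `NormalFormPlan3` — PROVED**: `DWalkTwoThirds3 → RingHardOdd 3` with `θ = 5/6`. -/
theorem normalFormPlan3 : NormalFormPlan3 := by
  intro hDW
  refine ⟨5 / 6, by norm_num, fun c => ?_⟩
  obtain ⟨n₀, hn₀⟩ := hDW (1 / 4) (by norm_num) (c + 1)
  refine ⟨max n₀ 16, fun N hN P hP => ?_⟩
  have hn₀N : n₀ ≤ N := le_trans (le_max_left _ _) hN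
  have h16 : 16 ≤ N := le_trans (le_max_right _ _) hN
  -- the bells
  set w : Fin N → CubeFn (ZMod 3) N := fun k => bellOf (P k) k with hw
  have hwdeg : ∀ k, w k ∈ lowDeg (ZMod 3) N ((Nat.log 2 N) ^ (c + 1)) := fun k =>
    lowDeg_mono (deg_bookkeeping h16 c) (bellOf_mem_lowDeg (hP k) k)
  have hcount := hn₀ N hn₀N w hwdeg
  -- identify the solved odd patterns with the winning odd patterns of the normal form
  have hset : (univ.filter fun x : Fin N → Bool => OddZeros x ∧ Rel x (fun i => decide (P i x = 1))) =
      univ.filter fun x : Fin N → Bool =>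
        (univ.filter fun b : Fin N => x b = false).card % 2 = 1 ∧
          (univ.filter fun k : Fin N => w k x = 1 ∧ Dk3 x k.val ≠ 1).card % 2 = 1 := by
    ext x
    simp only [mem_filter, mem_univ, true_and]
    constructor
    · rintro ⟨hodd, hrel⟩
      refine ⟨hodd, ?_⟩
      rw [traceForm (by omega) x hodd] at hrel
      have heq : (univ.filter fun k : Fin N => xor (decide (P k x = 1)) (tGuess x k) = true ∧
            (k.val + N + Wk x k.val + Wk x (N - 1)) % 3 ≠ 2) =
          univ.filter fun k : Fin N => w k x = 1 ∧ Dk3 x k.val ≠ 1 := by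
        ext k
        simp only [mem_filter, mem_univ, true_and, hw, bellOf_eq_one_iff, dk3_ne_one_iff]
      rw [heq] at hrel
      exact hrel
    · rintro ⟨hodd, hwin⟩
      refine ⟨hodd, ?_⟩
      rw [traceForm (by omega) x hodd]
      have heq : (univ.filter fun k : Fin N => xor (decide (P k x = 1)) (tGuess x k) = true ∧
            (k.val + N + Wk x k.val + Wk x (N - 1)) % 3 ≠ 2) =
          univ.filter fun k : Fin N => w k x = 1 ∧ Dk3 x k.val ≠ 1 := by
        ext k
        simp only [mem_filter, mem_univ, true_and, hw, bellOf_eq_one_iff, dk3_ne_one_iff]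
      rw [heq]
      exact hwin
  rw [hset]
  have hpow : (2 : ℝ) ^ N = 2 * (2 : ℝ) ^ (N - 1) := by
    rw [← pow_succ']; congr 1; omega
  rw [hpow] at hcount
  linarith

end Summit.QuantumAdvantage.AdviceFreeQNC0

end
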